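import Mathlib
import HarnessLib
import Summits.NavierStokesRegularity.NavierStokesRegularity.Theses.EfficiencyFloor

/-!
# Route `EfficiencyFloor`, support `CoveringUpgrade` (stmt-NavierStokesRegularity-25484) — THE COVERING LEMMA, proved

Pure real analysis (LINE ns-idea-5 g3 «extremiser frame», part 4/4 of `LerayFloorGap`).  A positive function `Zr` on `[t₀,T)` with
`Zr' = D ≤ K·Zr³`, `Zr → ∞` at `T⁻`, and the WINDOW PROPERTY «at every instant `s` where the cubic law is `(1−δ)`-saturated,
`Zr(t) ≤ A·Zr(s)` for `t ∈ [s, s + (2K)⁻¹ Zr(s)⁻²]`» satisfies `Zr(t)⁻² ≤ θ·2K·(T−t)` on `[t₀,T)` with ONE constant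
`θ = θ(δ, A) = max(1 − δ/2, (2A²+1)/(2A²+2)) < 1`.

Proof (the refuter-checked route; cf2-ref g5, 2026-08-28T03:56Z): `Y = Zr⁻²` has `Y′ = −2D/Zr³ ≥ −2K`, so `s ↦ Y(s) + 2Ks` is
monotone and `Y → 0` at `T⁻` gives RUNG ZERO `Y(s) ≤ 2K(T−s)`.  If `Y(t) > 2Kθ(T−t)`, the mean value theorem on `[t, t+(T−t)/2]`
(`exists_hasDerivAt_eq_slope`) produces `ξ` with `Y′(ξ) < −2K(1−δ)`, a `(1−δ)`-SATURATED instant; its window either reaches `T`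
(then `Zr ≤ A·Zr(ξ)` up to `T`, contradicting blow-up) or ends at `e = ξ + Y(ξ)/(2K) < T` where the amplification bound and rung zero
give `(A²+1)·Y(ξ) ≤ 2K·A²·(T−ξ)`, while `Y′ ≥ −2K` from `t` to `ξ` and `ξ − t ≤ (T−t)/2` give `(A²+1)·Y(ξ) > 2K·A²·(T−ξ)`.

HONEST FRAMING: an ODE covering lemma serving a door-route support; nothing here bears on Navier–Stokes regularity.
-/

noncomputable section

set_option linter.dupNamespace false

namespace Summit.NavierStokesRegularity.NavierStokesRegularity.Theorems.EfficiencyFloorCoveringUpgrade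

open Set Filter Topology

/-- **`CoveringUpgrade` (stmt-NavierStokesRegularity-25484)** — the covering lemma with `θ = max (1 − δ/2) ((2A²+1)/(2A²+2))`.
[cite: Leray1934, §20 (the `(T−t)^{1/2}` blow-up rate bookkeeping)] -/
theorem efficiencyFloor_coveringUpgrade_proof :
    Summit.NavierStokesRegularity.NavierStokesRegularity.Theses.EfficiencyFloor.CoveringUpgrade := by
  intro δ A hδ hA
  set θ : ℝ := max (1 - δ / 2) ((2 * A ^ 2 + 1) / (2 * A ^ 2 + 2)) with hθ
  have hA2 : 0 < 2 * A ^ 2 + 2 := by positivity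
  have hθ1 : θ < 1 := by
    refine max_lt (by linarith) ?_
    rw [div_lt_one hA2]; linarith
  have hθ0 : 0 ≤ θ := by
    refine le_trans ?_ (le_max_right _ _)
    exact div_nonneg (by positivity) hA2.le
  have hθδ : 1 - δ / 2 ≤ θ := le_max_left _ _
  have hθA : (2 * A ^ 2 + 1) / (2 * A ^ 2 + 2) ≤ θ := le_max_right _ _
  refine ⟨θ, hθ0, hθ1, ?_⟩
  intro K hK Zr D t₀ T ht₀T hODE hblow hwin
  have hK2 : 0 < 2 * K := by linarith
  -- `Y = Zr⁻²` and its derivative `−2D/Zr³ ≥ −2K` on `[t₀, T)`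
  set Y : ℝ → ℝ := fun s => (Zr s ^ 2)⁻¹ with hYdef
  have hYeq : ∀ s, (Zr s)⁻¹ ^ 2 = Y s := fun s => by simp only [hYdef, inv_pow]
  have hYder : ∀ s ∈ Ico t₀ T, HasDerivAt Y (-(2 * D s) / Zr s ^ 3) s := by
    intro s hs
    obtain ⟨hpos, hder, -⟩ := hODE s hs
    have h := (hder.pow 2).inv (pow_ne_zero 2 hpos.ne')
    refine h.congr_deriv ?_
    have hz : Zr s ≠ 0 := hpos.ne'
    simp only [Pi.pow_apply]
    push_cast
    field_simp
  have hYder_ge : ∀ s ∈ Ico t₀ T, -(2 * K) ≤ -(2 * D s) / Zr s ^ 3 := by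
    intro s hs
    obtain ⟨hpos, -, hD⟩ := hODE s hs
    have h3 : 0 < Zr s ^ 3 := pow_pos hpos 3
    rw [le_div_iff₀ h3]
    linarith
  have hYpos : ∀ s ∈ Ico t₀ T, 0 < Y s := fun s hs => by
    simp only [hYdef]; exact inv_pos.2 (pow_pos (hODE s hs).1 2)
  have hYcont : ∀ s ∈ Ico t₀ T, ContinuousAt Y s := fun s hs => (hYder s hs).continuousAt
  -- `G(s) = Y(s) + 2K s` is monotone on `[t₀, T)`
  have hmono : MonotoneOn (fun s => Y s + 2 * K * s) (Ico t₀ T) := by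
    refine monotoneOn_of_hasDerivWithinAt_nonneg (convex_Ico t₀ T) (f' := fun s => -(2 * D s) / Zr s ^ 3 + 2 * K)
      ?_ ?_ ?_
    · intro s hs
      exact ((hYcont s hs).add ((continuous_const.mul continuous_id).continuousAt)).continuousWithinAt
    · intro s hs
      rw [interior_Ico] at hs
      have h := (hYder s (Ioo_subset_Ico_self hs)).add ((hasDerivAt_id s).const_mul (2 * K))
      simp only [mul_one] at h
      exact h.hasDerivWithinAt
    · intro s hs
      rw [interior_Ico] at hs
      have := hYder_ge s (Ioo_subset_Ico_self hs)
      linarith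
  have hmono' : ∀ s u, s ∈ Ico t₀ T → u ∈ Ico t₀ T → s ≤ u → Y s ≤ Y u + 2 * K * (u - s) := by
    intro s u hs hu hsu
    have := hmono hs hu hsu
    simp only at this
    linarith
  -- `Y → 0` at `T⁻`: for every `ε > 0` and `s < T` there is `u ∈ (s, T)` with `Y u ≤ ε`
  have hsmall : ∀ ε : ℝ, 0 < ε → ∀ s, s < T → ∃ u, s < u ∧ u < T ∧ Y u ≤ ε := by
    intro ε hε s hs
    set N : ℝ := Real.sqrt ε⁻¹ with hN
    have hN0 : 0 < N := Real.sqrt_pos.2 (inv_pos.2 hε)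
    have h1 : ∀ᶠ u in 𝓝[<] T, s < u := mem_nhdsWithin_of_mem_nhds (Ioi_mem_nhds hs)
    have h2 : ∀ᶠ u in 𝓝[<] T, u < T := self_mem_nhdsWithin
    obtain ⟨u, hNu, hsu, huT⟩ := ((hblow N).and (h1.and h2)).exists
    refine ⟨u, hsu, huT, ?_⟩
    have hZu : 0 < Zr u := lt_of_lt_of_le hN0 hNu
    simp only [hYdef]
    rw [inv_le_comm₀ (pow_pos hZu 2) hε]
    calc ε⁻¹ = N ^ 2 := (Real.sq_sqrt (inv_pos.2 hε).le).symm
      _ ≤ Zr u ^ 2 := pow_le_pow_left₀ hN0.le hNu 2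
  -- RUNG ZERO: `Y(s) ≤ 2K (T − s)` on `[t₀, T)`
  have hrung : ∀ s ∈ Ico t₀ T, Y s ≤ 2 * K * (T - s) := by
    intro s hs
    refine le_of_forall_pos_le_add fun ε hε => ?_
    obtain ⟨u, hsu, huT, hYu⟩ := hsmall ε hε s hs.2
    have hu : u ∈ Ico t₀ T := ⟨le_trans hs.1 hsu.le, huT⟩
    have h1 := hmono' s u hs hu hsu.le
    have h2 : 2 * K * (u - s) ≤ 2 * K * (T - s) := mul_le_mul_of_nonneg_left (by linarith) hK2.le
    linarith
  -- the claim
  intro t ht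
  rw [hYeq]
  by_contra hcon'
  have hcon : θ * (2 * K) * (T - t) < Y t := not_le.1 hcon'
  have hTt : 0 < T - t := by linarith [ht.2]
  set t' : ℝ := t + (T - t) / 2 with ht'
  have htt' : t < t' := by rw [ht']; linarith
  have ht'T : t' < T := by rw [ht']; linarith
  have ht'I : t' ∈ Ico t₀ T := ⟨by linarith [ht.1], ht'T⟩
  have hsubI : Icc t t' ⊆ Ico t₀ T := fun x hx => ⟨le_trans ht.1 hx.1, lt_of_le_of_lt hx.2 ht'T⟩
  -- MVT on `[t, t']`
  obtain ⟨ξ, hξ, hξslope⟩ := exists_hasDerivAt_eq_slope Y (fun s => -(2 * D s) / Zr s ^ 3) htt'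
    (fun x hx => (hYcont x (hsubI hx)).continuousWithinAt)
    (fun x hx => hYder x (hsubI (Ioo_subset_Icc_self hx)))
  have hξI : ξ ∈ Ico t₀ T := hsubI (Ioo_subset_Icc_self hξ)
  obtain ⟨hZξ, -, hDξ⟩ := hODE ξ hξI
  -- the slope is `< −2K(1−δ)`: `Y t' ≤ K (T − t)` (rung zero) and `Y t > 2Kθ(T−t)`, `θ ≥ 1 − δ/2`
  have hYt' : Y t' ≤ K * (T - t) := by
    have := hrung t' ht'I
    have e : 2 * K * (T - t') = K * (T - t) := by rw [ht']; ring
    linarith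
  have hslope : -(2 * D ξ) / Zr ξ ^ 3 < -(2 * K) * (1 - δ) := by
    rw [hξslope, div_lt_iff₀ (by linarith : 0 < t' - t)]
    have e1 : t' - t = (T - t) / 2 := by rw [ht']; ring
    rw [e1]
    have h1 : θ * (2 * K) * (T - t) ≥ (1 - δ / 2) * (2 * K) * (T - t) :=
      mul_le_mul_of_nonneg_right (mul_le_mul_of_nonneg_right hθδ hK2.le) hTt.le
    linarith
  -- hence `ξ` is `(1 − δ)`-saturated
  have hsat : (1 - δ) * K * Zr ξ ^ 3 ≤ D ξ := by
    have h3 : 0 < Zr ξ ^ 3 := pow_pos hZξ 3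
    rw [div_lt_iff₀ h3] at hslope
    linarith
  have hwinξ := hwin ξ hξI hsat
  -- lower bound at `ξ`: `Y ξ > 2Kθ(T − t) − 2K(ξ − t)` (monotonicity from `t` to `ξ`)
  have hYξ_lb : θ * (2 * K) * (T - t) - 2 * K * (ξ - t) < Y ξ := by
    have := hmono' t ξ ht hξI hξ.1.le
    linarith
  have hYξpos : 0 < Y ξ := hYpos ξ hξI
  have hξt : ξ - t ≤ (T - t) / 2 := by
    have := hξ.2; rw [ht'] at this; linarith
  -- the window end `e = ξ + Y ξ/(2K)`
  set e : ℝ := ξ + Y ξ / (2 * K) with he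
  rcases le_or_gt T e with hTe | heT
  · -- case (a): the window reaches `T` — contradiction with blow-up
    obtain ⟨u, hξu, huT, hZu⟩ : ∃ u, ξ < u ∧ u < T ∧ A * Zr ξ + 1 ≤ Zr u := by
      have h1 : ∀ᶠ u in 𝓝[<] T, ξ < u := mem_nhdsWithin_of_mem_nhds (Ioi_mem_nhds hξI.2)
      have h2 : ∀ᶠ u in 𝓝[<] T, u < T := self_mem_nhdsWithin
      obtain ⟨u, hNu, hsu, huT⟩ := ((hblow (A * Zr ξ + 1)).and (h1.and h2)).exists
      exact ⟨u, hsu, huT, hNu⟩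
    have hwu : u - ξ ≤ (2 * K)⁻¹ * (Zr ξ)⁻¹ ^ 2 := by
      rw [hYeq ξ]
      have : u - ξ ≤ Y ξ / (2 * K) := by rw [he] at hTe; linarith
      rwa [div_eq_inv_mul] at this
    have := hwinξ u ⟨hξu.le, huT⟩ hwu
    linarith
  · -- case (b): the window ends at `e < T`; amplification + rung zero at `e`
    have hξe : ξ ≤ e := by rw [he]; exact le_add_of_nonneg_right (div_nonneg hYξpos.le hK2.le)
    have heI : e ∈ Ico ξ T := ⟨hξe, heT⟩
    have heI' : e ∈ Ico t₀ T := ⟨le_trans hξI.1 hξe, heT⟩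
    have hwe : e - ξ ≤ (2 * K)⁻¹ * (Zr ξ)⁻¹ ^ 2 := by
      rw [hYeq ξ, he, div_eq_inv_mul]; linarith
    have hZe := hwinξ e heI hwe
    -- amplification: `Y e ≥ Y ξ / A²`, i.e. `Y ξ ≤ A² · Y e`
    have hZepos : 0 < Zr e := (hODE e heI').1
    have hYe_lb : Y ξ ≤ A ^ 2 * Y e := by
      simp only [hYdef]
      rw [← div_eq_mul_inv, le_div_iff₀ (pow_pos hZepos 2), inv_mul_eq_div, div_le_iff₀ (pow_pos hZξ 2)]
      calc Zr e ^ 2 ≤ (A * Zr ξ) ^ 2 := pow_le_pow_left₀ hZepos.le hZe 2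
        _ = A ^ 2 * Zr ξ ^ 2 := mul_pow A (Zr ξ) 2
    -- rung zero at `e`
    have hYe_ub : Y e ≤ 2 * K * (T - e) := hrung e heI'
    have hTe' : 2 * K * (T - e) = 2 * K * (T - ξ) - Y ξ := by
      rw [he]; field_simp; ring
    -- (U): `(A² + 1) Y ξ ≤ 2K A² (T − ξ)`
    have hU : (A ^ 2 + 1) * Y ξ ≤ 2 * K * A ^ 2 * (T - ξ) := by
      have h1 : A ^ 2 * Y e ≤ A ^ 2 * (2 * K * (T - ξ) - Y ξ) := by
        rw [← hTe']; exact mul_le_mul_of_nonneg_left hYe_ub (sq_nonneg A)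
      linarith
    -- (L): `(A² + 1) Y ξ > 2K A² (T − ξ)` from the lower bound, `θ ≥ (2A²+1)/(2A²+2)` and `ξ − t ≤ (T−t)/2`
    have hθA' : (2 * A ^ 2 + 1) ≤ θ * (2 * A ^ 2 + 2) := by
      rwa [div_le_iff₀ hA2] at hθA
    have hL : 2 * K * A ^ 2 * (T - ξ) < (A ^ 2 + 1) * Y ξ := by
      have hA21 : 0 < A ^ 2 + 1 := by positivity
      have h1 : (A ^ 2 + 1) * (θ * (2 * K) * (T - t) - 2 * K * (ξ - t)) < (A ^ 2 + 1) * Y ξ :=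
        mul_lt_mul_of_pos_left hYξ_lb hA21
      have h2 : 2 * K * A ^ 2 * (T - ξ) ≤ (A ^ 2 + 1) * (θ * (2 * K) * (T - t) - 2 * K * (ξ - t)) := by
        -- `(A²+1)θ ≥ (2A²+1)/2`, and `ξ − t ≤ (T−t)/2`
        have hθA'' : 2 * A ^ 2 + 1 ≤ 2 * (A ^ 2 + 1) * θ := by linarith
        have h3 : (2 * A ^ 2 + 1) * (K * (T - t)) ≤ 2 * (A ^ 2 + 1) * θ * (K * (T - t)) :=
          mul_le_mul_of_nonneg_right hθA'' (mul_nonneg hK.le hTt.le)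
        have h4 : K * (ξ - t) ≤ K * ((T - t) / 2) := mul_le_mul_of_nonneg_left hξt hK.le
        have h5 : 0 ≤ A ^ 2 * (K * ((T - t) / 2) - K * (ξ - t)) := mul_nonneg (sq_nonneg A) (by linarith)
        linarith
      linarith
    linarith

end Summit.NavierStokesRegularity.NavierStokesRegularity.Theorems.EfficiencyFloorCoveringUpgrade

end
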